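import Literature.Topology.FourManifolds.GenericMapCuspsFinite
import Literature.Topology.FourManifolds.FoldChartSigCritical
import Literature.Topology.Immersions.SurjectiveDifferentialOpenManifold
import HarnessLib

/-!
# Structure of the singular locus of a generic map from a closed 4-manifold to the sphere

Topic `Literature/Topology/FourManifolds` (programme of the fact
`Literature.Topology.FourManifolds.exists_isSimplifiedBrokenLefschetzFibration`, Baykur–Saeki 2017, §2.1
p. 6: for a generic map `f : X⁴ → Σ²` the singular locus is a compact 1-dimensional
submanifold — folds along arcs/circles and finitely many cusps — and `f` restricted to the fold
locus is an immersion).  Packaging of the lane: a `C^∞` map `g : M → S²` with a finite cusp set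
`S` (Whitney data in charts), fold charts at all other critical points, compact critical set
(`Literature.Topology.Immersions.isCompact_setOf_not_surjective_mfderiv_of_contMDiff`), and, near each fold point, the critical set is the `φ`-preimage of the `t`-axis with `g`
injective on it.

* `HasManifoldFoldChart.exists_chart_critical` — local structure of the critical set at a
  fold point with charts;
* **`exists_generic_map_sphere_structured`**.

Everything is proved; no definitions, no named facts (D-0026).

## References

* R. İ. Baykur, O. Saeki, *Simplifying indefinite fibrations on 4-manifolds*, arXiv:1705.11169,
  §2.1 p. 6, §6 p. 19. [BaykurSaeki2017]
* M. Golubitsky, V. Guillemin, *Stable Mappings and Their Singularities*, GTM 14 (1973), Ch. III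
  §4; Ch. VI §2. [GolubitskyGuillemin1973]
-/

noncomputable section

set_option maxSynthPendingDepth 2

open Set Function Filter Module
open scoped ContDiff Topology Manifold

namespace Literature.Topology.FourManifolds

/-- Local notation for this file: the model space `ℝⁿ = EuclideanSpace ℝ (Fin n)`. -/
local notation "𝔼 " n:arg => EuclideanSpace ℝ (Fin n)

/-- Local notation: the round 2-sphere. -/
local notation "𝕊²" => Metric.sphere (0 : EuclideanSpace ℝ (Fin 3)) 1

section FoldLocus

variable {X : Type*} [TopologicalSpace X] [ChartedSpace (𝔼 4) X]
  {B : Type*} [TopologicalSpace B] [ChartedSpace (𝔼 2) B]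

/-- **The critical set near a fold point with charts**: there is a chart `φ` of `X` at `p` in
which the critical points are exactly `φ⁻¹` of the `t`-axis, and `g` is injective on them.
[cite: BaykurSaeki2017, §2.1, p. 6] -/
theorem HasManifoldFoldChart.exists_chart_critical {g : X → B} {p : X}
    (h : HasManifoldFoldChart g p) :
    ∃ φ : OpenPartialHomeomorph X (𝔼 4), p ∈ φ.source ∧ φ p = 0 ∧
      InjOn g (φ.source ∩ {q | ¬ Surjective (mfderiv (𝓡 4) (𝓡 2) g q)}) ∧
      φ.source ∩ {q | ¬ Surjective (mfderiv (𝓡 4) (𝓡 2) g q)} =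
        φ.source ∩ φ ⁻¹' {x | x 1 = 0 ∧ x 2 = 0 ∧ x 3 = 0} := by
  obtain ⟨s₁, s₂, s₃, φ, ψ, hs₁, hs₂, hs₃, hp, hp0, hmaps, hφ, hφs, hψ, hψs, hid⟩ := h
  have hs₁0 : s₁ ≠ 0 := by rintro rfl; norm_num at hs₁
  have hs₂0 : s₂ ≠ 0 := by rintro rfl; norm_num at hs₂
  have hs₃0 : s₃ ≠ 0 := by rintro rfl; norm_num at hs₃
  exact ⟨φ, hp, hp0, injOn_of_foldChartSig hmaps hφ hφs hψ hψs hid hs₁0 hs₂0 hs₃0,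
    inter_setOf_not_surjective_eq_of_foldChartSig hmaps hφ hφs hψ hψs hid hs₁0 hs₂0 hs₃0⟩

end FoldLocus

/-- **The singular locus of a generic map `M⁴ → S²`** (Baykur–Saeki §2.1).  Every compact
boundaryless `C^∞` 4-manifold carries a `C^∞` map `g : M → S²` and a finite set `S ⊆ M` with:
every point of `S` is a cusp point with Whitney data in charts; every critical point off `S` is
a fold point with charts `(t, s₁x² + s₂y² + s₃z²)`, `sᵢ = ±1`; the critical set is compact; and
at every critical point off `S` some chart `φ` of `M` straightens the critical set to the
`t`-axis, with `g` injective on it (so `g` restricted to the fold locus is locally an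
embedding of an arc). [cite: BaykurSaeki2017, §2.1 p. 6, §6 p. 19] -/
theorem exists_generic_map_sphere_structured (M : Type*) [TopologicalSpace M] [T2Space M]
    [CompactSpace M] [ChartedSpace (𝔼 4) M] [IsManifold (𝓡 4) ∞ M] :
    ∃ g : M → 𝕊², ContMDiff (𝓡 4) (𝓡 2) ∞ g ∧ ∃ S : Finset M,
      (∀ p ∈ S, HasManifoldWhitneyCuspCharts g p) ∧
      (∀ p : M, ¬ Surjective (mfderiv (𝓡 4) (𝓡 2) g p) → p ∉ S → HasManifoldFoldChart g p) ∧
      IsCompact {p : M | ¬ Surjective (mfderiv (𝓡 4) (𝓡 2) g p)} ∧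
      ∀ p : M, ¬ Surjective (mfderiv (𝓡 4) (𝓡 2) g p) → p ∉ S →
        ∃ φ : OpenPartialHomeomorph M (𝔼 4), p ∈ φ.source ∧ φ p = 0 ∧
          InjOn g (φ.source ∩ {q | ¬ Surjective (mfderiv (𝓡 4) (𝓡 2) g q)}) ∧
          φ.source ∩ {q | ¬ Surjective (mfderiv (𝓡 4) (𝓡 2) g q)} =
            φ.source ∩ φ ⁻¹' {x | x 1 = 0 ∧ x 2 = 0 ∧ x 3 = 0} := by
  obtain ⟨g, hg, S, hS, hfold⟩ := exists_generic_map_sphere_finite_cusps M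
  exact ⟨g, hg, S, hS, hfold,
    Literature.Topology.Immersions.isCompact_setOf_not_surjective_mfderiv_of_contMDiff hg (by simp),
    fun p hp hpS => (hfold p hp hpS).exists_chart_critical⟩

end Literature.Topology.FourManifolds
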